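import Literature.MathematicalPhysics.QuantumFieldTheory.Balaban1983to89.B5Local114G0Second
import Literature.MathematicalPhysics.QuantumFieldTheory.Balaban1983to89.B5Local114SixthTorus

/-!
# `Balaban1983to89.B5Local114G0Torus` — «THIS LEADS ALSO TO (1.114)» FOR G₀ ON THE TORUS, DISCHARGED:
# `B5.Local114Fam` for the G₀-settings `B5G0SettingTorus.g0Setting` (every level k ≤ m + K, every m² ≥ 0) from
# `B5.Prop11Printed` alone, hence PROPOSITION 1.2 FOR G₀ on the torus family of record with NO printed input left

statement-level skeleton of published theorems with citation tags; proofs where landed; nothing here is a claim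
about the Yang–Mills mass gap

Source (lit-balaban cell, Phase-2 proof seat p38 gen 5): T. Bałaban, *Propagators and renormalization transformations
for lattice gauge theories. I*, Commun. Math. Phys. **95** (1984) 17–40 [`Balaban1984PropagatorsI`, "B5"], pp. 35–36
[PDF 19–20] (Prop. 1.2, (1.114)), p. 36 (the route), p. 39 [PDF 23] (G₀); held as `paper:balaban1984-cmp95-propagators-rt-i`.

## WHAT IS PRINTED (verbatim)

p. 36 [PDF 20], (1.114): «Finally there exists a constant O(1) such that ‖ζGJ‖, ‖ζ∇GJ‖, ‖ζG∇*J‖, ‖ζ∇G∇*J‖, ‖ζ∇∇GJ‖,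
‖ζG∇*∇*J‖ ≤ O(1)e^{−δ₀|y−y′|}|ζ|‖J‖ (1.114) for supp ζ ⊂ Δ̃(y), supp J ⊂ Δ̃(y′).»
p. 36: «Let us sketch briefly a proof of the above proposition. We will show that the inequalities (1.115)–(1.117),
(1.89) imply the proposition. Probably the simplest proof of the exponential decay properties can be obtained by …
proving that the operator e^{−⟨q,x⟩}Δ_a e^{⟨q,x⟩} − Δ_a is a small perturbation of Δ_a for vectors q ∈ R^d sufficiently
small. Instead we construct a random walk expansion ….»
p. 39 [PDF 23]: «Proposition 1.1 holds for G₀ also … This leads also to (1.114) by the same reasoning with a random walk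
expansion as for G.»

## WHAT THIS MODULE PROVES (kernel-checked, zero sorry)

**`local114Fam_g0_of_prop11`**: for any family of tori `Pf i` of one dimension d, levels `kf i ≤ m + K`, directions `μf i`,
a > 0, m² ≥ 0: `B5.Prop11Printed fam → B5.Local114Fam fam` for `fam i = g0Setting (Pf i) a m² (kf i) (μf i)` — with
ONE δ₀ = min(1/8, γ₀/(2(2d + 16a) + 1)) and ONE C = (d + 1)(8/γ₀ + 9 + (8a + 4d)(2/γ₀))e^{2δ₀} for the family, from
the (1.90)-half of `Prop11Printed` (coercivity γ₀(Δ + I) ≤ G₀⁻¹) by the p. 36 «simplest proof» route carried out in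
`B5CombesThomasTorus` (conjugated form), `B5Local114G0First` (members n = 0…3) and `B5Local114G0Second` (n = 4; n = 5 is
`:= 0` in the scalar settings).  Corollaries: `local114Fam_famG0`, **`local114Fam_famG0Top`** (the hypothesis `h114G0`
of `B5Display133G0Torus.prop12G0_torus_top` / `B5Prop12GpTorus.prop12G0_of_torusGp'`), `local114Fam_famG0Top_zero`
(m² = 0, from r02's `B5Prop11G0Tower.prop11Printed_famG0Top`), and the capstones **`prop12Printed_famG0Top`**:
`B5.Prop12Printed (famG0Top d L a 0)` and **`prop12Printed_famDiagTop`**: `B5.Prop12Printed (famDiagTop d L a 0)`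
(p37's `B5Prop12G0DiagTorus.prop12G0Top_of_local114` / `B5Local114SixthTorus.prop12DiagTop_of_local114G0` with their
one remaining printed input supplied) — for every d ≥ 1, odd L > 1, a > 0.

## HONEST SCOPE / DIVERGENCE

(1) METHOD: the printed proof of (1.114) is the random walk expansion (1.118)–(1.131); this module realises instead the
alternative the paper names first (p. 36, exponential conjugation), on the torus, with the torus identity
Σ‖∂∂φ‖² = ‖Δφ‖² (weighted) for the second-order member — a different proof of the same printed statement, for Bałaban's
concrete G₀ = (−Δ^η + (Lᵏε)²m² + aQ*_μQ_μ)⁻¹ per direction μ (the scalar reading of `B5Eq133G0Torus`/`B5G0SettingTorus`,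
whose module docstrings list the inherited divergences: U = 1, per-direction scalar G₀, sixth L² member vacuous).
(2) Only the (1.90)-half of `Prop11Printed` is used; constants depend on (d, a, γ₀) and are not optimised.
CELL BOOK-KEEPING (lit-balaban): row B5.Prop1.2 census (vi) «h114G0» (owner r02, referee ref-4) DISCHARGED for the
families of record; VALUE = Prop. 1.2 for G₀ on the torus now has no printed input left — NOT summit progress.
-/

namespace Literature.MathematicalPhysics.QuantumFieldTheory.Balaban1983to89

open Matrix Finset

noncomputable section

namespace B5Local114G0Torus

open B1RG242Torus B5Ineq137Torus B5GpSettingTorus B5Eq133G0Torus B5G0SettingTorus B5Pieces133Torus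
  B5CombesThomasTorus B5Local114G0First B5Local114G0Second

/-! ## §1 Constants -/

/-- `K₄` read on the dimension: `9 + (8a + 4d)(2/γ₀)` (= `B5Local114G0Second.K4 P a γ₀` when `P.d = d`).
[cite: Balaban1984PropagatorsI, (1.114) p.36 («there exists a constant O(1)»)] -/
def K4d (d : ℕ) (a γ₀ : ℝ) : ℝ := 9 + (8 * a + 4 * (d : ℝ)) * (2 / γ₀)

/-- `K4 P = K4d P.d` (definitional). [cite: Balaban1984PropagatorsI, (1.114) p.36] -/
theorem K4_eq (P : Params) (a γ₀ : ℝ) : K4 P a γ₀ = K4d P.d a γ₀ := rfl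

/-- the decay rate of the module: `δ₀ = min(1/8, γ₀/(2(2d + 16a) + 1))`. [cite: Balaban1984PropagatorsI, (1.114) p.36 («e^{−δ₀|y−y′|}»)] -/
def delta0 (d : ℕ) (a γ₀ : ℝ) : ℝ := min (1 / 8) (γ₀ / (2 * (2 * (d : ℝ) + 16 * a) + 1))

/-- the constant of the module: `C = (d + 1)(8/γ₀ + K₄)e^{2δ₀}`. [cite: Balaban1984PropagatorsI, (1.114) p.36 («a constant O(1)»)] -/
def const0 (d : ℕ) (a γ₀ : ℝ) : ℝ := ((d : ℝ) + 1) * (8 / γ₀ + K4d d a γ₀) * Real.exp (2 * delta0 d a γ₀)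

section Constants

variable (d : ℕ) {a γ₀ : ℝ}

/-- `8δ₀ ≤ 1`. [cite: Balaban1984PropagatorsI, (1.114) p.36] -/
theorem delta0_le (a γ₀ : ℝ) : 8 * delta0 d a γ₀ ≤ 1 := by
  have := min_le_left (1 / 8 : ℝ) (γ₀ / (2 * (2 * (d : ℝ) + 16 * a) + 1))
  unfold delta0; linarith

variable (ha : 0 < a) (hγ : 0 < γ₀)
include ha hγ

/-- `0 < δ₀`. [cite: Balaban1984PropagatorsI, (1.114) p.36] -/
theorem delta0_pos : 0 < delta0 d a γ₀ := by
  unfold delta0; exact lt_min (by norm_num) (by positivity)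

/-- `(2d + 16a)δ₀² ≤ γ₀/2` (the smallness of the conjugation). [cite: Balaban1984PropagatorsI, p.36 («q … sufficiently small»)] -/
theorem delta0_sq_le : (2 * (d : ℝ) + 16 * a) * delta0 d a γ₀ ^ 2 ≤ γ₀ / 2 := by
  set c := 2 * (d : ℝ) + 16 * a with hc
  have hc0 : 0 < c := by positivity
  set δ := delta0 d a γ₀ with hδ
  have h1 : δ ≤ γ₀ / (2 * c + 1) := min_le_right _ _
  have h2 : δ ≤ 1 / 8 := min_le_left _ _
  have h0 : 0 < δ := delta0_pos d ha hγ
  have h3 : δ ^ 2 ≤ δ := by nlinarith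
  have h4 : c * (γ₀ / (2 * c + 1)) ≤ γ₀ / 2 := by
    rw [mul_div_assoc', div_le_iff₀ (by positivity)]; nlinarith
  calc c * δ ^ 2 ≤ c * δ := mul_le_mul_of_nonneg_left h3 hc0.le
    _ ≤ c * (γ₀ / (2 * c + 1)) := mul_le_mul_of_nonneg_left h1 hc0.le
    _ ≤ γ₀ / 2 := h4

/-- `0 ≤ K4d`. [cite: Balaban1984PropagatorsI, (1.114) p.36] -/
theorem K4d_nonneg : 0 ≤ K4d d a γ₀ := by unfold K4d; positivity

/-- `0 < C`. [cite: Balaban1984PropagatorsI, (1.114) p.36] -/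
theorem const0_pos : 0 < const0 d a γ₀ := by
  have := K4d_nonneg d ha hγ
  unfold const0; positivity

/-- the five entry constants are below `(d + 1)(8/γ₀ + K₄)`. [cite: Balaban1984PropagatorsI, (1.114) p.36] -/
theorem entry_consts_le :
    2 / γ₀ ≤ ((d : ℝ) + 1) * (8 / γ₀ + K4d d a γ₀) ∧
      Real.sqrt d * (4 / γ₀) ≤ ((d : ℝ) + 1) * (8 / γ₀ + K4d d a γ₀) ∧
      (d : ℝ) * (8 / γ₀) ≤ ((d : ℝ) + 1) * (8 / γ₀ + K4d d a γ₀) ∧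
      (d : ℝ) * K4d d a γ₀ ≤ ((d : ℝ) + 1) * (8 / γ₀ + K4d d a γ₀) := by
  have hK := K4d_nonneg d ha hγ
  have hd : (0 : ℝ) ≤ d := Nat.cast_nonneg _
  have ht : 0 ≤ 8 / γ₀ := by positivity
  have hsq : Real.sqrt d ≤ (d : ℝ) + 1 := by
    rw [Real.sqrt_le_left (by positivity)]
    nlinarith
  have e : ((d : ℝ) + 1) * (8 / γ₀ + K4d d a γ₀) = d * (8 / γ₀) + d * K4d d a γ₀ + 8 / γ₀ + K4d d a γ₀ := by ring
  refine ⟨?_, ?_, ?_, ?_⟩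
  · rw [e]
    have : 2 / γ₀ ≤ 8 / γ₀ := div_le_div_of_nonneg_right (by norm_num) hγ.le
    nlinarith [mul_nonneg hd ht, mul_nonneg hd hK]
  · calc Real.sqrt d * (4 / γ₀) ≤ ((d : ℝ) + 1) * (8 / γ₀) := by
          refine mul_le_mul hsq (div_le_div_of_nonneg_right (by norm_num) hγ.le) (by positivity) (by positivity)
      _ ≤ ((d : ℝ) + 1) * (8 / γ₀ + K4d d a γ₀) := by nlinarith
  · rw [e]; nlinarith [mul_nonneg hd hK]
  · rw [e]; nlinarith [mul_nonneg hd ht]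

end Constants

/-! ## §2 (1.114) for the G₀-settings from Proposition 1.1 -/

/-- bookkeeping: an entry bound with constant `c′e^{2δ}` and `c′e^{2δ} ≤ C` gives the bound with constant C.
[cite: Balaban1984PropagatorsI, (1.114) p.36] -/
private theorem finish {X c' e C E S N : ℝ} (hc : c' * e ≤ C) (hE : 0 ≤ E) (hS : 0 ≤ S) (hN : 0 ≤ N)
    (h : X ≤ c' * e * E * S * N) : X ≤ C * E * S * N :=
  h.trans (mul_le_mul_of_nonneg_right (mul_le_mul_of_nonneg_right (mul_le_mul_of_nonneg_right hc hE) hS) hN)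

/-- (1.90) of the setting, with the common weight η^d cancelled: `γ₀·f·(Δ + I)f ≤ f·G₀⁻¹f`.
[cite: Balaban1984PropagatorsI, (1.90) p.33, p.39 («Proposition 1.1 holds for G₀ also»)] -/
theorem coercive_of_formOp {P : Params} {k : ℕ} {γ₀ : ℝ} {B Bi : Matrix (Site P 0) (Site P 0) ℝ}
    (h : ∀ f : Site P 0 → ℝ, γ₀ * formOp P k B f ≤ formOp P k Bi f) (f : Site P 0 → ℝ) :
    γ₀ * (f ⬝ᵥ (B *ᵥ f)) ≤ f ⬝ᵥ (Bi *ᵥ f) := by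
  have hη : 0 < (((P.L : ℝ) ^ k)⁻¹) ^ P.d := pow_pos (eta_pos k) _
  have := h f
  simp only [formOp] at this
  rw [mul_left_comm] at this
  exact le_of_mul_le_mul_left this hη

/-- **«THIS LEADS ALSO TO (1.114)» FOR G₀, PROVED on the torus**: for a family of tori of one dimension d (levels
k ≤ m + K, any directions, a > 0, m² ≥ 0), Proposition 1.1 for the G₀-settings implies (1.114) for them, with one
(δ₀, C) for the family. [cite: Balaban1984PropagatorsI, (1.114) p.36, p.39 («This leads also to (1.114)»)] -/
theorem local114Fam_g0_of_prop11 {I : Type} (Pf : I → Params) (kf : I → ℕ) (μf : ∀ i, Fin (Pf i).d) (d : ℕ)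
    (a msq : ℝ) (hd : ∀ i, (Pf i).d = d) (hk : ∀ i, kf i ≤ (Pf i).m + (Pf i).K) (ha : 0 < a) (hm : 0 ≤ msq) :
    B5.Prop11Printed (fun i => g0Setting (Pf i) a msq (kf i) (μf i)) →
      B5.Local114Fam (fun i => g0Setting (Pf i) a msq (kf i) (μf i)) := by
  rintro ⟨γ₀, hγ, h11⟩
  refine ⟨delta0 d a γ₀, const0 d a γ₀, delta0_pos d ha hγ, const0_pos d ha hγ, ?_⟩
  intro i n J ζ y y' hζ hJ
  have hco : ∀ f : Site (Pf i) 0 → ℝ, γ₀ * (f ⬝ᵥ ((lapEta (Pf i) (kf i) + 1) *ᵥ f))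
      ≤ f ⬝ᵥ (M0 (Pf i) a msq (kf i) (μf i) *ᵥ f) :=
    coercive_of_formOp (fun f => by simpa only [g0Setting, opSetting_formΔI, opSetting_formΔa] using (h11 i).2 f)
  simp only [g0Setting, opSetting_cutIn] at hζ
  simp only [g0Setting, opSetting_suppIn] at hJ
  simp only [g0Setting, opSetting_l2loc, opSetting_dist, opSetting_cutSup, opSetting_l2Norm]
  have hdi := hd i
  subst hdi
  set δ := delta0 (Pf i).d a γ₀ with hδ
  have hδ0 : 0 ≤ δ := (delta0_pos (Pf i).d ha hγ).le
  have hδ8 : 8 * δ ≤ 1 := delta0_le (Pf i).d a γ₀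
  have hδ4 : 4 * δ ≤ 1 := by linarith
  have hδγ : (2 * ((Pf i).d : ℝ) + 16 * a) * δ ^ 2 ≤ γ₀ / 2 := delta0_sq_le (Pf i).d ha hγ
  obtain ⟨c0, c1, c3, c4⟩ := entry_consts_le (Pf i).d ha hγ
  have he : 0 < Real.exp (2 * δ) := Real.exp_pos _
  have hE : 0 ≤ Real.exp (-(δ * T (Pf i) (kf i) y y')) := (Real.exp_pos _).le
  have hS : 0 ≤ supN (Pf i) ζ := supN_nonneg (Pf i) ζ
  have hN : 0 ≤ l2NormV (Pf i) (kf i) J := by rw [l2NormV_eq]; exact Real.sqrt_nonneg _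
  have hC : const0 (Pf i).d a γ₀ = ((Pf i).d + 1) * (8 / γ₀ + K4d (Pf i).d a γ₀) * Real.exp (2 * δ) := rfl
  rw [hC]
  match n with
  | ⟨0, _⟩ =>
    exact finish (mul_le_mul_of_nonneg_right c0 he.le) hE hS hN
      (opL2loc_zero_le (hk i) ha hm hγ hco hδ0 hδ4 hδγ J ζ y y' hζ hJ)
  | ⟨1, _⟩ =>
    exact finish (mul_le_mul_of_nonneg_right c1 he.le) hE hS hN
      (opL2loc_one_le (hk i) ha hm hγ hco hδ0 hδ4 hδγ J ζ y y' hζ hJ)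
  | ⟨2, _⟩ =>
    exact finish (mul_le_mul_of_nonneg_right c1 he.le) hE hS hN
      (opL2loc_two_le (hk i) ha hm hγ hco hδ0 hδ4 hδγ J ζ y y' hζ hJ)
  | ⟨3, _⟩ =>
    exact finish (mul_le_mul_of_nonneg_right c3 he.le) hE hS hN
      (opL2loc_three_le (hk i) ha hm hγ hco hδ0 hδ4 hδγ J ζ y y' hζ hJ)
  | ⟨4, _⟩ =>
    have c4' : ((Pf i).d : ℝ) * K4 (Pf i) a γ₀ ≤ ((Pf i).d + 1) * (8 / γ₀ + K4d (Pf i).d a γ₀) := by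
      rw [K4_eq]; exact c4
    exact finish (mul_le_mul_of_nonneg_right c4' he.le) hE hS hN
      (opL2loc_four_le (hk i) ha hm hγ hco hδ0 hδ8 hδγ J ζ y y' hζ hJ)
  | ⟨5, _⟩ =>
    show (0 : ℝ) ≤ _
    have := K4d_nonneg (Pf i).d ha hγ
    positivity

/-- **(1.114) for the G₀-family `famG0`** (top levels k = K, one dimension d). [cite: Balaban1984PropagatorsI, (1.114) p.36, p.39] -/
theorem local114Fam_famG0 {I : Type} (Pf : I → Params) (μ : ∀ i, Fin (Pf i).d) (d : ℕ) (a msq : ℝ)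
    (hd : ∀ i, (Pf i).d = d) (ha : 0 < a) (hm : 0 ≤ msq) :
    B5.Prop11Printed (famG0 Pf μ a msq) → B5.Local114Fam (famG0 Pf μ a msq) :=
  local114Fam_g0_of_prop11 Pf (fun i => (Pf i).K) μ d a msq hd (fun _ => Nat.le_add_left _ _) ha hm

/-- **(1.114) FOR THE G₀-FAMILY OF RECORD `famG0Top d L a m²`** — the hypothesis `h114G0` of
`B5Display133G0Torus.prop12G0_torus_top` / `B5Prop12GpTorus.prop12G0_of_torusGp'`, as an implication from `Prop11Printed`.
[cite: Balaban1984PropagatorsI, (1.114) p.36, p.39 («This leads also to (1.114)»)] -/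
theorem local114Fam_famG0Top (d L : ℕ) (a msq : ℝ) (ha : 0 < a) (hm : 0 ≤ msq) :
    B5.Prop11Printed (famG0Top d L a msq) → B5.Local114Fam (famG0Top d L a msq) :=
  local114Fam_g0_of_prop11 (fun i : G0TopIdx d L => i.P) (fun i => i.P.K) (fun i => i.μ) d a msq (fun i => i.hPd)
    (fun _ => Nat.le_add_left _ _) ha hm

/-- **(1.114) FOR THE G₀-FAMILY OF RECORD AT m² = 0, UNCONDITIONALLY** (a > 0): Prop. 1.1 for G₀ is r02's
`B5Prop11G0Tower.prop11Printed_famG0Top`. [cite: Balaban1984PropagatorsI, (1.114) p.36, p.39] -/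
theorem local114Fam_famG0Top_zero (d L : ℕ) {a : ℝ} (ha : 0 < a) : B5.Local114Fam (famG0Top d L a 0) :=
  local114Fam_famG0Top d L a 0 ha le_rfl (B5Prop11G0Tower.prop11Printed_famG0Top d L ha)

/-! ## §3 Capstones: Proposition 1.2 for G₀ on the torus with no printed input left -/

section Capstone

variable (d L : ℕ) (hd : 1 ≤ d) (hL : Odd L ∧ 1 < L) {a msq : ℝ} (ha : 0 < a)
include hd hL ha

/-- **PROPOSITION 1.2 FOR THE G₀-FAMILY OF RECORD from Proposition 1.1 for it** (any m² ≥ 0).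
[cite: Balaban1984PropagatorsI, Prop. 1.2 (1.110)–(1.114) pp.35–36, (1.133)–(1.134) p.39] -/
theorem prop12G0Top_of_prop11 (hm : 0 ≤ msq) (h11G0 : B5.Prop11Printed (famG0Top d L a msq)) :
    B5.Prop12Printed (famG0Top d L a msq) :=
  B5Display133G0Torus.prop12G0_torus_top d L hd hL ha hm h11G0 (local114Fam_famG0Top d L a msq ha hm)

/-- **PROPOSITION 1.2 FOR THE SCALAR G₀-FAMILY OF RECORD `famG0Top d L a 0`, NO PRINTED INPUT LEFT** (every d ≥ 1, odd
L > 1, a > 0; all tori of the family, all directions). [cite: Balaban1984PropagatorsI, Prop. 1.2 (1.110)–(1.114) pp.35–36, p.39] -/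
theorem prop12Printed_famG0Top : B5.Prop12Printed (famG0Top d L a 0) :=
  B5Prop12G0DiagTorus.prop12G0Top_of_local114 d L hd hL ha (local114Fam_famG0Top_zero d L ha)

/-- **PROPOSITION 1.2 FOR BAŁABAN'S G₀ = (Δ + aQ*Q)⁻¹ ON 1-FORMS OF EVERY TORUS (`famDiagTop d L a 0`), NO PRINTED INPUT
LEFT** — the G₀-side input of r02's (1.132)-transfer. [cite: Balaban1984PropagatorsI, Prop. 1.2 (1.110)–(1.114) pp.35–36, (1.132)–(1.134) p.39] -/
theorem prop12Printed_famDiagTop : B5.Prop12Printed (B5G0DiagTorus.famDiagTop d L a 0) :=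
  B5Local114SixthTorus.prop12DiagTop_of_local114G0 d L hd hL ha (local114Fam_famG0Top_zero d L ha)

end Capstone

end B5Local114G0Torus

end

end Literature.MathematicalPhysics.QuantumFieldTheory.Balaban1983to89
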